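import Summits.Ventures.HodgeRepro.Night1AndreRational

/-!
# The `ℚ`-structure of a non-free orbit piece: the rational Pohlmann class of `f` is the SIGN-TWISTED TRACE
of `f` to the fixed field of the stabiliser, spread over the cosets — `f_Δ^*(ratWeil f) = 0 ⟺ Tr^{sgn}(f) = 0`

Blind re-derivation cell `pub-hodge-repro`, seat `night-1` (gen 6).  Imports night-1's `Night1AndreRational`
(`ratPohlmann φ₀ Δ e f = Σ_g φ₀(g f) • e_{g • Δ}` = `f_Δ^*(ratWeil f)`, with the wedge `e_{g • Δ}` ENUMERATED
through `e` as `deltaEnum Δ e g`).  Namespace `HodgeRepro.RouteC`.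

For `h` in the stabiliser `H = Stab_G(Δ)` the enumerations `deltaEnum Δ e (g h)` and `deltaEnum Δ e g` of the
SAME set `g • Δ` differ by the permutation `indPerm e h` of `Fin n` that `h` induces on `Δ` through `e`
(`deltaEnum_mul_mem_stabilizer`), so the wedges differ by its sign `stabSign e h = ± 1`
(`coordWedgeOn_deltaEnum_mul_mem_stabilizer`).  Grouping the sum over `G` by the cosets of `H`:

* `twistedTrace K e f = Σ_{h ∈ H} stabSign e h • h(f)` — the sign-twisted trace of `f ∈ K` to `K^H`
  (the ordinary trace `Tr_{K/K^H}` when `H` acts on `Δ` by even permutations);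
* **`ratPohlmann_eq_sum_quotient`** — `ratPohlmann f = Σ_{q ∈ G/H} φ₀(q̄ (Tr^{sgn} f)) • e_{q̄ • Δ}` (one wedge
  per coset, at the representative `q̄ = q.out`);
* `linearIndependent_deltaEnum_out` — the coset wedges are linearly independent (distinct sets);
* **`ratPohlmann_eq_zero_iff`** — `f_Δ^*(ratWeil f) = 0 ⟺ Tr^{sgn}(f) = 0`: the kernel of the `ℚ`-linear
  map `K → f_Δ^*(W_F(A_Δ)) ⊗ ℂ`, `f ↦ f_Δ^*(ratWeil f)`, is the kernel of the sign-twisted trace; its image —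
  the `ℚ`-form of the orbit piece of Theorem 1 — is the image of `Tr^{sgn}` (of `ℚ`-dimension `[K : K^H] =
  |G • Δ|` by the normal basis theorem, not formalised).

Nothing geometric is built.  Nothing here says anything about the status of the Hodge conjecture for CM
abelian varieties, which is NOT proved.
-/

set_option autoImplicit false

open Finset Module
open scoped Pointwise Classical

namespace HodgeRepro.RouteC

open CMHodge CMHodgeOn

/-! ### The permutation of `Δ` induced by an element of its stabiliser, and its sign -/

section Perm

variable {G : Type*} [Group G] {X : Type*} [MulAction G X] [DecidableEq X]

/-- An element of the stabiliser of `Δ` maps `Δ` into itself. -/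
theorem smul_mem_of_mem_stabilizer {Δ : Finset X} {h : G} (hh : h ∈ MulAction.stabilizer G Δ) {s : X}
    (hs : s ∈ Δ) : h • s ∈ Δ := by
  have := Finset.smul_mem_smul_finset (a := h) hs
  rwa [MulAction.mem_stabilizer_iff.1 hh] at this

/-- **The permutation of `Fin n` induced by `h ∈ Stab_G(Δ)` through the enumeration `e`**:
`j ↦ e⁻¹ (h • e j)`. -/
def indPerm {n : ℕ} {Δ : Finset X} (e : Fin n ≃ ↥Δ) (h : ↥(MulAction.stabilizer G Δ)) : Equiv.Perm (Fin n) where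
  toFun j := e.symm ⟨(h : G) • ((e j : ↥Δ) : X), smul_mem_of_mem_stabilizer h.2 (e j).2⟩
  invFun j := e.symm ⟨(h : G)⁻¹ • ((e j : ↥Δ) : X),
    smul_mem_of_mem_stabilizer ((MulAction.stabilizer G Δ).inv_mem h.2) (e j).2⟩
  left_inv j := by
    apply e.injective
    rw [Equiv.apply_symm_apply]
    apply Subtype.ext
    show (h : G)⁻¹ • ((e (e.symm ⟨(h : G) • ((e j : ↥Δ) : X), _⟩) : ↥Δ) : X) = ((e j : ↥Δ) : X)
    rw [Equiv.apply_symm_apply]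
    exact inv_smul_smul (h : G) _
  right_inv j := by
    apply e.injective
    rw [Equiv.apply_symm_apply]
    apply Subtype.ext
    show (h : G) • ((e (e.symm ⟨(h : G)⁻¹ • ((e j : ↥Δ) : X), _⟩) : ↥Δ) : X) = ((e j : ↥Δ) : X)
    rw [Equiv.apply_symm_apply]
    exact smul_inv_smul (h : G) _

/-- The induced permutation, applied: `e (indPerm e h j) = h • e j`. -/
theorem coe_apply_indPerm {n : ℕ} {Δ : Finset X} (e : Fin n ≃ ↥Δ) (h : ↥(MulAction.stabilizer G Δ))
    (j : Fin n) : ((e (indPerm e h j) : ↥Δ) : X) = (h : G) • ((e j : ↥Δ) : X) := by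
  rw [show indPerm e h j = e.symm ⟨(h : G) • ((e j : ↥Δ) : X), smul_mem_of_mem_stabilizer h.2 (e j).2⟩ from
    rfl, Equiv.apply_symm_apply]

/-- **Two enumerations of one translate**: for `h ∈ Stab_G(Δ)`, `deltaEnum Δ e (g h) = deltaEnum Δ e g ∘ indPerm e h`. -/
theorem deltaEnum_mul_mem_stabilizer {n : ℕ} {Δ : Finset X} (e : Fin n ≃ ↥Δ) (g : G)
    (h : ↥(MulAction.stabilizer G Δ)) :
    deltaEnum Δ e (g * h) = deltaEnum Δ e g ∘ indPerm e h := by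
  funext j
  simp only [deltaEnum, Function.comp_apply, coe_apply_indPerm, mul_smul]

/-- **The sign character of the stabiliser on `Δ`** (through the enumeration `e`). -/
def stabSign {n : ℕ} {Δ : Finset X} (e : Fin n ≃ ↥Δ) (h : ↥(MulAction.stabilizer G Δ)) : ℤ :=
  (Equiv.Perm.sign (indPerm e h) : ℤ)

/-- The sign is non-zero. -/
theorem stabSign_ne_zero {n : ℕ} {Δ : Finset X} (e : Fin n ≃ ↥Δ) (h : ↥(MulAction.stabilizer G Δ)) :
    stabSign e h ≠ 0 :=
  Units.ne_zero _

/-- **The wedges of the two enumerations differ by the sign**: `e_{deltaEnum Δ e (g h)} = stabSign e h • e_{deltaEnum Δ e g}`. -/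
theorem coordWedgeOn_deltaEnum_mul_mem_stabilizer {n : ℕ} {Δ : Finset X} (e : Fin n ≃ ↥Δ) (g : G)
    (h : ↥(MulAction.stabilizer G Δ)) :
    coordWedgeOn n (deltaEnum Δ e (g * h)) = ((stabSign e h : ℤ) : ℂ) • coordWedgeOn n (deltaEnum Δ e g) := by
  rw [deltaEnum_mul_mem_stabilizer]
  unfold coordWedgeOn stabSign
  have h1 := AlternatingMap.map_perm (exteriorPower.ιMulti ℂ n (M := X → ℂ))
    (fun j => coordVecOn (deltaEnum Δ e g j)) (indPerm e h)
  rw [Units.smul_def, ← Int.cast_smul_eq_zsmul (R := ℂ)] at h1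
  exact h1

end Perm

/-! ### The sign-twisted trace and the coset form of the rational Pohlmann class -/

section Trace

variable (K : Type*) [Field K] [NumberField K] [IsGalois ℚ K] (φ₀ : K →+* ℂ)
variable {X : Type*} [MulAction (K ≃ₐ[ℚ] K) X] [Fintype X] [DecidableEq X]

/-- **The sign-twisted trace** of `f ∈ K` to the fixed field of `Stab_G(Δ)`: `Σ_{h ∈ H} stabSign e h • h(f)`. -/
noncomputable def twistedTrace {n : ℕ} {Δ : Finset X} (e : Fin n ≃ ↥Δ) (f : K) : K :=
  ∑ h : ↥(MulAction.stabilizer (K ≃ₐ[ℚ] K) Δ), stabSign e h • ((h : K ≃ₐ[ℚ] K) f)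

omit [IsGalois ℚ K] [Fintype X] in
/-- The fibre of the quotient map over `q` is the coset `q.out · H`, enumerated by `H`. -/
theorem filter_mk_eq_eq_image {Δ : Finset X}
    (q : (K ≃ₐ[ℚ] K) ⧸ MulAction.stabilizer (K ≃ₐ[ℚ] K) Δ) :
    (univ.filter fun g : K ≃ₐ[ℚ] K => (QuotientGroup.mk g : (K ≃ₐ[ℚ] K) ⧸ MulAction.stabilizer (K ≃ₐ[ℚ] K) Δ) = q) =
      (univ : Finset ↥(MulAction.stabilizer (K ≃ₐ[ℚ] K) Δ)).image
        fun h : ↥(MulAction.stabilizer (K ≃ₐ[ℚ] K) Δ) => q.out * (h : K ≃ₐ[ℚ] K) := by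
  ext g
  rw [mem_filter, mem_image]
  constructor
  · rintro ⟨-, hg⟩
    have hmem : q.out⁻¹ * g ∈ MulAction.stabilizer (K ≃ₐ[ℚ] K) Δ := by
      rw [← QuotientGroup.eq, QuotientGroup.out_eq']
      exact hg.symm
    exact ⟨(⟨q.out⁻¹ * g, hmem⟩ : ↥(MulAction.stabilizer (K ≃ₐ[ℚ] K) Δ)), mem_univ _, by simp⟩
  · rintro ⟨h, -, rfl⟩
    exact ⟨mem_univ _, by rw [QuotientGroup.mk_mul_of_mem _ h.2, QuotientGroup.out_eq']⟩

omit [IsGalois ℚ K] [Fintype X] in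
/-- **The coset form of the rational Pohlmann class**: grouping `Σ_g φ₀(g f) e_{g • Δ}` by the cosets of the
stabiliser, `ratPohlmann f = Σ_{q ∈ G/H} φ₀(q̄ (Tr^{sgn} f)) • e_{q̄ • Δ}` with `q̄ = q.out`. -/
theorem ratPohlmann_eq_sum_quotient {p : ℕ} (Δ : Finset X) (e : Fin (2 * p) ≃ ↥Δ) (f : K) :
    ratPohlmann K φ₀ Δ e f =
      ∑ q : (K ≃ₐ[ℚ] K) ⧸ MulAction.stabilizer (K ≃ₐ[ℚ] K) Δ,
        φ₀ (q.out (twistedTrace K e f)) • coordWedgeOn (2 * p) (deltaEnum Δ e q.out) := by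
  unfold ratPohlmann
  rw [← Finset.sum_fiberwise (univ : Finset (K ≃ₐ[ℚ] K))
    (fun g => (QuotientGroup.mk g : (K ≃ₐ[ℚ] K) ⧸ MulAction.stabilizer (K ≃ₐ[ℚ] K) Δ))]
  refine Finset.sum_congr rfl fun q _ => ?_
  rw [filter_mk_eq_eq_image, Finset.sum_image (fun h _ h' _ hh => Subtype.ext (mul_left_cancel hh))]
  simp_rw [coordWedgeOn_deltaEnum_mul_mem_stabilizer, smul_smul, ← Finset.sum_smul]
  congr 1
  unfold twistedTrace
  rw [map_sum, map_sum]
  refine Finset.sum_congr rfl fun h _ => ?_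
  rw [map_zsmul, map_zsmul, zsmul_eq_mul, AlgEquiv.mul_apply, mul_comm]

omit [IsGalois ℚ K] [Fintype X] in
/-- Distinct cosets give distinct translates of `Δ`. -/
theorem out_smul_injective (Δ : Finset X) :
    Function.Injective fun q : (K ≃ₐ[ℚ] K) ⧸ MulAction.stabilizer (K ≃ₐ[ℚ] K) Δ => q.out • Δ := by
  intro q q' h
  have h' : q.out • Δ = q'.out • Δ := h
  have hmem : q.out⁻¹ * q'.out ∈ MulAction.stabilizer (K ≃ₐ[ℚ] K) Δ := by
    rw [MulAction.mem_stabilizer_iff, mul_smul, ← h', inv_smul_smul]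
  rw [← QuotientGroup.out_eq' q, ← QuotientGroup.out_eq' q', QuotientGroup.eq]
  exact hmem

omit [IsGalois ℚ K] [Fintype X] in
/-- The coset wedges `e_{q̄ • Δ}`, one per coset, are linearly independent. -/
theorem linearIndependent_deltaEnum_out {p : ℕ} (Δ : Finset X) (e : Fin (2 * p) ≃ ↥Δ) :
    LinearIndependent ℂ fun q : (K ≃ₐ[ℚ] K) ⧸ MulAction.stabilizer (K ≃ₐ[ℚ] K) Δ =>
      coordWedgeOn (2 * p) (deltaEnum Δ e q.out) :=
  linearIndependent_coordWedgeOn _ (fun q => deltaEnum_injective Δ e q.out) fun q q' hqq' => by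
    show univ.image (deltaEnum Δ e q.out) ≠ univ.image (deltaEnum Δ e q'.out)
    rw [image_deltaEnum, image_deltaEnum]
    exact fun h => hqq' (out_smul_injective K Δ h)

omit [IsGalois ℚ K] [Fintype X] in
/-- **The kernel of `f ↦ f_Δ^*(ratWeil f)` is the kernel of the sign-twisted trace**:
`ratPohlmann f = 0 ⟺ Tr^{sgn}(f) = 0`. -/
theorem ratPohlmann_eq_zero_iff {p : ℕ} (Δ : Finset X) (e : Fin (2 * p) ≃ ↥Δ) (f : K) :
    ratPohlmann K φ₀ Δ e f = 0 ↔ twistedTrace K e f = 0 := by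
  rw [ratPohlmann_eq_sum_quotient]
  constructor
  · intro h
    have h0 := (Fintype.linearIndependent_iff.1 (linearIndependent_deltaEnum_out K Δ e)) _ h
      (QuotientGroup.mk (1 : K ≃ₐ[ℚ] K))
    exact (AlgEquiv.injective _) (φ₀.injective (by rwa [map_zero, map_zero]))
  · intro h
    rw [h]
    simp

end Trace

end HodgeRepro.RouteC
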